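import Summits.CriticalPhenomena.PercolationContinuityZ3.Theorems.PercNearOneGluingNoHeavyLowerTailCovTauA2EdgeDefs
import Summits.CriticalPhenomena.PercolationContinuityZ3.Theorems.PercNearOneGluingNoHeavyLowerTailCovTauAssembly
import HarnessLib

/-!
# The dictionary between the (A2) weight-sum framework and
# the A2-diagonal hypothesis of `CovTau.covTau_of_diagonal`

The files `…CovTauA2*.lean` prove the two-source inequality (A2) of the COV(τ) proof in
the finite weight-sum framework of `ConditionalPositiveAssociationProofs.lean` (`BHK2006.weight`, percolation
restricted to a `Finset U` via `ω ∩ edgesIn U`, clusters `rC`, avoidance events `rD`) with the functionals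
`CovTau.Ef / Mf / qf / cf` (`…CovTauA2Defs`) and, for EDGE-cluster functionals `g`, `CovTau.tfE / BfE / YfE / XfE`
(`…CovTauA2EdgeDefs`); its diagonal `N = N' = {y}` reads `Ef·YfE ≤ Mf·XfE`.  The final step
`CovTau.covTau_of_diagonal` (…CovTauAssembly) takes the same inequality in `prodBernoulli` language: worlds `G ∖ C_y(ω)` as
ZEROED weights on the pairs meeting the open vertex cluster of `y`, integrals, `U = univ`.  THIS FILE is the dictionary:

* `inter_edgesIn_univ`, `rC_univ`, `rD_univ`, `mem_sC_univ` — restriction to `univ` is no restriction;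
* `sum_weight_mul_eq_integral`, `sum_weight_ind`, `sum_weight_mul_ind`, `sum_weight_coe_eq_one` — weight sums are integrals;
* `Mf_univ_singleton = μ(v↮x, v↮y)`, `Ef_univ_singleton = μ(v↮x, v↮y, v↔o)`;
* `inter_edgesIn_rest_univ` — restricting to the world `rest univ {y} ω = V ∖ C_y(ω)` deletes exactly the pairs meeting `C_y(ω)`;
  `sum_weight_rest_univ` — fresh sums in that world are zeroed-weight integrals (`BHK2006.integral_comp_sdiff_prodBernoulli`);
* `BfE_rest_univ`, `qf_rest_univ`, `YfE_univ_singleton`, `XfE_univ_singleton` — the brackets and the two integrals of `CovTau.covTau_of_diagonal`;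
* `diagonal_of_sumForm` — the sum-form diagonal inequality (all non-degenerate weights, all monotone `g ≥ 0` on edge sets)
  IS the hypothesis `H` of `CovTau.covTau_of_diagonal`; `covTau_of_sumForm` — hence COV(τ) from the sum form.
[cite: VandenbergHaggstromKahn2005, §1 pp. 3–4, §2.1 Lemmas 2.3–2.4 (p. 10)] [cite: KozmaNitzan2024, Conj. 1 (p. 3)]
-/

noncomputable section

namespace Summit.CriticalPhenomena.PercolationContinuityZ3.Theorems

namespace CovTau

open MeasureTheory Set Literature.Probability.Percolation
open Literature.Probability.LatticeModels (prodBernoulli)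
open scoped Classical
open BHK2006 DecisionTree

variable {V : Type*} [Fintype V]

/-! ### Percolation restricted to `univ` is percolation; weight sums are integrals -/

omit [Fintype V] in
/-- `ind D` is the real indicator of `D`. [folklore] -/
theorem ind_eq_indicator_one (D : Set (BondConfig V)) : (fun ω => ind D ω) = D.indicator (1 : BondConfig V → ℝ) := by
  funext ω
  by_cases h : ω ∈ D
  · rw [ind_of_mem h, indicator_of_mem h, Pi.one_apply]
  · rw [ind_of_not_mem h, indicator_of_notMem h]

omit [Fintype V] in
/-- `1{o ∈ C_v}` read on the edge cluster is the indicator of `{v ↔ o}`. [folklore] -/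
theorem oInd_openEdgeCluster (o v : V) (ζ : Set (Sym2 V)) :
    oInd o v (openEdgeCluster ζ v) = ind (openConn v o : Set (BondConfig V)) ζ := by
  rw [oInd]
  by_cases h : (openGraph ζ).Reachable v o
  · rw [ind_of_mem (show ζ ∈ (openConn v o : Set (BondConfig V)) from h),
      ind_of_mem (show openEdgeCluster ζ v ∈ {C : Set (Sym2 V) | o = v ∨ ∃ e ∈ C, o ∈ e} from
        (reachable_iff_exists_mem_openEdgeCluster ζ v o).1 h)]
  · rw [ind_of_not_mem (show ζ ∉ (openConn v o : Set (BondConfig V)) from h),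
      ind_of_not_mem (show openEdgeCluster ζ v ∉ {C : Set (Sym2 V) | o = v ∨ ∃ e ∈ C, o ∈ e} from
        fun h' => h ((reachable_iff_exists_mem_openEdgeCluster ζ v o).2 h'))]

/-- Every pair lies in `edgesIn univ`. [folklore] -/
theorem inter_edgesIn_univ (ω : Set (Sym2 V)) : ω ∩ BHK2006.edgesIn (Finset.univ : Finset V) = ω := by
  ext e
  simp only [mem_inter_iff, BHK2006.edgesIn, Finset.mem_univ, implies_true, mem_setOf_eq, and_true]

/-- `rC univ s ω = C_s(ω)`. [folklore] -/
theorem rC_univ (s : V) (ω : Set (Sym2 V)) : rC (Finset.univ : Finset V) s ω = openEdgeCluster ω s := by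
  rw [rC, inter_edgesIn_univ]

/-- `rD univ s X = {s ↮ X}`. [folklore] -/
theorem rD_univ (s : V) (X : Set V) :
    rD (Finset.univ : Finset V) s X = {ω : Set (Sym2 V) | ∀ x ∈ X, ¬ (openGraph ω).Reachable s x} := by
  ext ω; simp only [rD, inter_edgesIn_univ, mem_setOf_eq]

/-- `sC univ N ω` is the open vertex cluster of the set `N`. [folklore] -/
theorem mem_sC_univ {N : Set V} {ω : Set (Sym2 V)} {u : V} :
    u ∈ sC (Finset.univ : Finset V) N ω ↔ ∃ z ∈ N, (openGraph ω).Reachable z u := by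
  rw [mem_sC, inter_edgesIn_univ]

/-- Weight sums are integrals against `prodBernoulli`. [folklore] -/
theorem sum_weight_mul_eq_integral (p : Sym2 V → unitInterval) (F : Set (Sym2 V) → ℝ) :
    ∑ ω, weight (fun e => (p e : ℝ)) ω * F ω = ∫ ω, F ω ∂(prodBernoulli p) :=
  (integral_prodBernoulli_eq_sum p F).symm

/-- `Σ weight · 1_D = μ(D)`. [folklore] -/
theorem sum_weight_ind (p : Sym2 V → unitInterval) (D : Set (BondConfig V)) :
    ∑ ω, weight (fun e => (p e : ℝ)) ω * ind D ω = (prodBernoulli p).real D := by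
  rw [sum_weight_mul_eq_integral, ind_eq_indicator_one, integral_indicator_one MeasurableSet.of_discrete]

/-- `Σ weight · F · 1_D = ∫_D F`. [folklore] -/
theorem sum_weight_mul_ind (p : Sym2 V → unitInterval) (F : Set (Sym2 V) → ℝ) (D : Set (BondConfig V)) :
    ∑ ω, weight (fun e => (p e : ℝ)) ω * (F ω * ind D ω) = ∫ ω in D, F ω ∂(prodBernoulli p) := by
  rw [sum_weight_mul_eq_integral, ← integral_indicator MeasurableSet.of_discrete]
  congr 1
  funext ω
  by_cases h : ω ∈ D
  · rw [ind_of_mem h, mul_one, indicator_of_mem h]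
  · rw [ind_of_not_mem h, mul_zero, indicator_of_notMem h]

/-- The total weight is `1`. [folklore] -/
theorem sum_weight_coe_eq_one (p : Sym2 V → unitInterval) : ∑ ω, weight (fun e => (p e : ℝ)) ω = 1 := by
  have h := sum_weight_mul_eq_integral p fun _ => (1 : ℝ)
  simp only [mul_one, integral_const, probReal_univ, smul_eq_mul] at h
  exact h

/-! ### The constants `E({y})`, `M({y})` -/

/-- `M({y}) = μ(v ↮ x, v ↮ y)` (in `G = G[univ]`). [cite: VandenbergHaggstromKahn2005, §1 p. 3] -/
theorem Mf_univ_singleton (p : Sym2 V → unitInterval) (x v y : V) :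
    Mf (fun e => (p e : ℝ)) Finset.univ x v ({y} : Set V) =
      (prodBernoulli p).real ({ω : BondConfig V | ¬ (openGraph ω).Reachable v x} ∩
        {ω | ¬ (openGraph ω).Reachable v y}) := by
  rw [Mf, rD_univ, sum_weight_ind]
  congr 1
  ext ω
  simp only [mem_setOf_eq, mem_insert_iff, mem_singleton_iff, forall_eq_or_imp, forall_eq, mem_inter_iff]

/-- `E({y}) = μ(v ↮ x, v ↮ y, v ↔ o)` (in `G = G[univ]`). [cite: VandenbergHaggstromKahn2005, §1 p. 3] -/
theorem Ef_univ_singleton (p : Sym2 V → unitInterval) (x o v y : V) :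
    Ef (fun e => (p e : ℝ)) Finset.univ x o v ({y} : Set V) =
      (prodBernoulli p).real ({ω : BondConfig V | ¬ (openGraph ω).Reachable v x} ∩
        {ω | ¬ (openGraph ω).Reachable v y} ∩ openConn v o) := by
  rw [Ef, ← sum_weight_ind]
  refine Finset.sum_congr rfl fun ω _ => ?_
  congr 1
  rw [rC_univ, rD_univ, oInd_openEdgeCluster, ← ind_inter, inter_comm]
  congr 1
  ext ω'
  simp only [mem_inter_iff, mem_setOf_eq, mem_insert_iff, mem_singleton_iff, forall_eq_or_imp, forall_eq]

/-! ### The worlds `G ∖ C_y(ω)`: restriction to `rest univ {y} ω` is deletion of the pairs meeting `C_y(ω)` -/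

/-- In the world `U = V ∖ C_y(ω)`, restricting a configuration to `edgesIn U` deletes exactly the pairs meeting the
open vertex cluster of `y`. [cite: VandenbergHaggstromKahn2005, §2.1 Lemma 2.3 (p. 10)] -/
theorem inter_edgesIn_rest_univ (y : V) (ω η : Set (Sym2 V)) :
    η ∩ BHK2006.edgesIn (rest Finset.univ ({y} : Set V) ω) = η \ {e | ∃ u ∈ e, (openGraph ω).Reachable y u} := by
  ext e
  simp only [mem_inter_iff, BHK2006.edgesIn, mem_setOf_eq, mem_sdiff, not_exists, not_and]
  constructor
  · rintro ⟨he, h⟩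
    refine ⟨he, fun u hu hr => ?_⟩
    have := (mem_rest.1 (h u hu)).2
    exact this (mem_sC_univ.2 ⟨y, rfl, hr⟩)
  · rintro ⟨he, h⟩
    refine ⟨he, fun u hu => mem_rest.2 ⟨Finset.mem_univ u, fun hC => ?_⟩⟩
    obtain ⟨z, hz, hr⟩ := mem_sC_univ.1 hC
    rw [mem_singleton_iff.1 hz] at hr
    exact h u hu hr

/-- **Fresh expectations in the world `G ∖ C_y(ω)` are zeroed-weight integrals**: for any `G`,
`Σ_η weight(η) G(η ∩ edgesIn(V ∖ C_y ω)) = ∫ G dμ_{p^ω}`, `p^ω` the weights zeroed on the pairs meeting `C_y(ω)`.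
[cite: VandenbergHaggstromKahn2005, §2.1 Lemmas 2.3–2.4 (p. 10)] -/
theorem sum_weight_rest_univ (p : Sym2 V → unitInterval) (y : V) (ω : Set (Sym2 V)) (G : Set (Sym2 V) → ℝ) :
    ∑ η, weight (fun e => (p e : ℝ)) η * G (η ∩ BHK2006.edgesIn (rest Finset.univ ({y} : Set V) ω)) =
      ∫ η, G η ∂(prodBernoulli fun e => if (∃ u ∈ e, (openGraph ω).Reachable y u) then (0 : unitInterval) else p e) := by
  simp only [inter_edgesIn_rest_univ]
  rw [sum_weight_mul_eq_integral, integral_comp_sdiff_prodBernoulli p {e | ∃ u ∈ e, (openGraph ω).Reachable y u} G]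
  congr 2
  funext e
  by_cases h : ∃ u ∈ e, (openGraph ω).Reachable y u
  · rw [if_pos h, if_pos (show e ∈ {e : Sym2 V | ∃ u ∈ e, (openGraph ω).Reachable y u} from h)]
  · rw [if_neg h, if_neg (show e ∉ {e : Sym2 V | ∃ u ∈ e, (openGraph ω).Reachable y u} from h)]

/-- `B = Cov(g(C_x), 1{x ↔ v})` in the world `G ∖ C_y(ω)`, as the zeroed-weight bracket of the A2-diagonal hypothesis.
[cite: VandenbergHaggstromKahn2005, §1 p. 6, §2.1 Lemmas 2.3–2.4 (p. 10)] -/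
theorem BfE_rest_univ (p : Sym2 V → unitInterval) (x v y : V) (g : Set (Sym2 V) → ℝ) (ω : Set (Sym2 V)) :
    BfE (fun e => (p e : ℝ)) (rest Finset.univ ({y} : Set V) ω) x v g =
      (∫ η in (openConn x v : Set (BondConfig V)), g (openEdgeCluster η x)
          ∂(prodBernoulli fun e => if (∃ u ∈ e, (openGraph ω).Reachable y u) then (0 : unitInterval) else p e)) -
        (∫ η, g (openEdgeCluster η x)
          ∂(prodBernoulli fun e => if (∃ u ∈ e, (openGraph ω).Reachable y u) then (0 : unitInterval) else p e)) *
        (prodBernoulli fun e => if (∃ u ∈ e, (openGraph ω).Reachable y u) then (0 : unitInterval) else p e).real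
          (openConn x v : Set (BondConfig V)) := by
  -- the three sums of `BfE` as zeroed-weight integrals (definitional unfolding of `rC`, `ind`, `openConn`)
  have h1 : tfE (fun e => (p e : ℝ)) (rest Finset.univ ({y} : Set V) ω) x g = ∫ η, g (openEdgeCluster η x)
      ∂(prodBernoulli fun e => if (∃ u ∈ e, (openGraph ω).Reachable y u) then (0 : unitInterval) else p e) :=
    sum_weight_rest_univ p y ω (fun ζ => g (openEdgeCluster ζ x))
  have h2 : cf (fun e => (p e : ℝ)) (rest Finset.univ ({y} : Set V) ω) x v =
      ∫ η, ind (openConn x v : Set (BondConfig V)) η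
        ∂(prodBernoulli fun e => if (∃ u ∈ e, (openGraph ω).Reachable y u) then (0 : unitInterval) else p e) :=
    sum_weight_rest_univ p y ω (fun ζ => ind (openConn x v : Set (BondConfig V)) ζ)
  have h3 : (∑ η, weight (fun e => (p e : ℝ)) η * (g (rC (rest Finset.univ ({y} : Set V) ω) x η) *
      ind {η : Set (Sym2 V) | (openGraph (η ∩ BHK2006.edgesIn (rest Finset.univ ({y} : Set V) ω))).Reachable x v} η)) =
      ∫ η, g (openEdgeCluster η x) * ind (openConn x v : Set (BondConfig V)) η
        ∂(prodBernoulli fun e => if (∃ u ∈ e, (openGraph ω).Reachable y u) then (0 : unitInterval) else p e) :=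
    sum_weight_rest_univ p y ω (fun ζ => g (openEdgeCluster ζ x) * ind (openConn x v : Set (BondConfig V)) ζ)
  rw [BfE, h1, h2, h3, ind_eq_indicator_one, integral_indicator_one MeasurableSet.of_discrete]
  congr 1
  rw [← integral_indicator MeasurableSet.of_discrete]
  congr 1
  funext η
  by_cases h : η ∈ (openConn x v : Set (BondConfig V))
  · rw [ind_of_mem h, mul_one, indicator_of_mem h]
  · rw [ind_of_not_mem h, mul_zero, indicator_of_notMem h]

/-- `q = μ(v ↔ o | v ↮ x)` in the world `G ∖ C_y(ω)` (real division, `0/0 = 0`).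
[cite: VandenbergHaggstromKahn2005, §2.1 Lemmas 2.3–2.4 (p. 10)] -/
theorem qf_rest_univ (p : Sym2 V → unitInterval) (x o v y : V) (ω : Set (Sym2 V)) :
    qf (fun e => (p e : ℝ)) (rest Finset.univ ({y} : Set V) ω) x o v =
      (prodBernoulli fun e => if (∃ u ∈ e, (openGraph ω).Reachable y u) then (0 : unitInterval) else p e).real
          ({η : BondConfig V | ¬ (openGraph η).Reachable v x} ∩ openConn v o) /
        (prodBernoulli fun e => if (∃ u ∈ e, (openGraph ω).Reachable y u) then (0 : unitInterval) else p e).real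
          {η : BondConfig V | ¬ (openGraph η).Reachable v x} := by
  have h1 : Ef (fun e => (p e : ℝ)) (rest Finset.univ ({y} : Set V) ω) x o v ∅ =
      ∫ η, ind ({η : BondConfig V | ¬ (openGraph η).Reachable v x} ∩ openConn v o) η
        ∂(prodBernoulli fun e => if (∃ u ∈ e, (openGraph ω).Reachable y u) then (0 : unitInterval) else p e) := by
    have h := sum_weight_rest_univ p y ω (fun ζ => oInd o v (openEdgeCluster ζ v) *
      ind {ζ : Set (Sym2 V) | ∀ z ∈ insert x (∅ : Set V), ¬ (openGraph ζ).Reachable v z} ζ)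
    refine (Eq.trans (by rfl) h).trans ?_
    congr 1
    funext η
    rw [oInd_openEdgeCluster, ← ind_inter, inter_comm]
    congr 2
    ext ζ
    simp only [insert_empty_eq, mem_singleton_iff, forall_eq]
  have h2 : Mf (fun e => (p e : ℝ)) (rest Finset.univ ({y} : Set V) ω) x v ∅ =
      ∫ η, ind {η : BondConfig V | ¬ (openGraph η).Reachable v x} η
        ∂(prodBernoulli fun e => if (∃ u ∈ e, (openGraph ω).Reachable y u) then (0 : unitInterval) else p e) := by
    have h := sum_weight_rest_univ p y ω (fun ζ =>
      ind {ζ : Set (Sym2 V) | ∀ z ∈ insert x (∅ : Set V), ¬ (openGraph ζ).Reachable v z} ζ)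
    refine (Eq.trans (by rfl) h).trans ?_
    congr 1
    funext η
    congr 2
    ext ζ
    simp only [insert_empty_eq, mem_singleton_iff, forall_eq]
  rw [qf, h1, h2, ind_eq_indicator_one, ind_eq_indicator_one, integral_indicator_one MeasurableSet.of_discrete,
    integral_indicator_one MeasurableSet.of_discrete]

/-- **`Y({y})` is the left integral of the A2-diagonal hypothesis**: `E[B(C_y); x ∉ C_y] = ∫_{x↮y} Cov_{p^ω}(g(C_x), 1{x↔v}) dμ_p(ω)`.
[cite: VandenbergHaggstromKahn2005, §1 p. 4, §2.1 Lemma 2.4 (p. 10)] -/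
theorem YfE_univ_singleton (p : Sym2 V → unitInterval) (x v y : V) (g : Set (Sym2 V) → ℝ) :
    YfE (fun e => (p e : ℝ)) Finset.univ x v g ({y} : Set V) =
      ∫ ω in {ω : BondConfig V | ¬ (openGraph ω).Reachable x y},
        ((∫ η in (openConn x v : Set (BondConfig V)), g (openEdgeCluster η x)
            ∂(prodBernoulli fun e => if (∃ u ∈ e, (openGraph ω).Reachable y u) then (0 : unitInterval) else p e)) -
          (∫ η, g (openEdgeCluster η x)
            ∂(prodBernoulli fun e => if (∃ u ∈ e, (openGraph ω).Reachable y u) then (0 : unitInterval) else p e)) *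
          (prodBernoulli fun e => if (∃ u ∈ e, (openGraph ω).Reachable y u) then (0 : unitInterval) else p e).real
            (openConn x v : Set (BondConfig V))) ∂(prodBernoulli p) := by
  rw [YfE]
  simp only [BfE_rest_univ, rD_univ, mem_singleton_iff, forall_eq]
  exact sum_weight_mul_ind p _ _

/-- **`X({y})` is the right integral of the A2-diagonal hypothesis**: `E[q(C_y) B(C_y); x ∉ C_y]`.
[cite: VandenbergHaggstromKahn2005, §1 p. 4, §2.1 Lemma 2.4 (p. 10)] -/
theorem XfE_univ_singleton (p : Sym2 V → unitInterval) (x o v y : V) (g : Set (Sym2 V) → ℝ) :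
    XfE (fun e => (p e : ℝ)) Finset.univ x o v g ({y} : Set V) =
      ∫ ω in {ω : BondConfig V | ¬ (openGraph ω).Reachable x y},
        ((prodBernoulli fun e => if (∃ u ∈ e, (openGraph ω).Reachable y u) then (0 : unitInterval) else p e).real
            ({η : BondConfig V | ¬ (openGraph η).Reachable v x} ∩ openConn v o) /
          (prodBernoulli fun e => if (∃ u ∈ e, (openGraph ω).Reachable y u) then (0 : unitInterval) else p e).real
            {η : BondConfig V | ¬ (openGraph η).Reachable v x}) *
        ((∫ η in (openConn x v : Set (BondConfig V)), g (openEdgeCluster η x)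
            ∂(prodBernoulli fun e => if (∃ u ∈ e, (openGraph ω).Reachable y u) then (0 : unitInterval) else p e)) -
          (∫ η, g (openEdgeCluster η x)
            ∂(prodBernoulli fun e => if (∃ u ∈ e, (openGraph ω).Reachable y u) then (0 : unitInterval) else p e)) *
          (prodBernoulli fun e => if (∃ u ∈ e, (openGraph ω).Reachable y u) then (0 : unitInterval) else p e).real
            (openConn x v : Set (BondConfig V))) ∂(prodBernoulli p) := by
  rw [XfE]
  simp only [BfE_rest_univ, qf_rest_univ, rD_univ, mem_singleton_iff, forall_eq]
  exact sum_weight_mul_ind p _ _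

/-- **The A2-diagonal hypothesis of `CovTau.covTau_of_diagonal` from its sum form** (
`E({y})·Y({y}) ≤ M({y})·X({y})` in the BHK2006 weight-sum framework, `U = univ`, for every non-degenerate weight and
every monotone nonnegative edge-cluster functional): the two are the same inequality.
[cite: VandenbergHaggstromKahn2005, §1 pp. 3–4, §2.1 Lemma 2.4 (p. 10)] -/
theorem diagonal_of_sumForm (x y o v : V)
    (hP1 : ∀ p : Sym2 V → unitInterval, (∀ e, 0 < p e ∧ p e < 1) →
      ∀ g : Set (Sym2 V) → ℝ, Monotone g → (∀ C, 0 ≤ g C) →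
      Ef (fun e => (p e : ℝ)) Finset.univ x o v ({y} : Set V) * YfE (fun e => (p e : ℝ)) Finset.univ x v g ({y} : Set V) ≤
        Mf (fun e => (p e : ℝ)) Finset.univ x v ({y} : Set V) * XfE (fun e => (p e : ℝ)) Finset.univ x o v g ({y} : Set V)) :
    ∀ p : Sym2 V → unitInterval, (∀ e, 0 < p e ∧ p e < 1) →
      ∀ g : Set (Sym2 V) → ℝ, Monotone g → (∀ C, 0 ≤ g C) →
      (prodBernoulli p).real ({ω : BondConfig V | ¬ (openGraph ω).Reachable v x} ∩
          {ω | ¬ (openGraph ω).Reachable v y} ∩ openConn v o) *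
        (∫ ω in {ω : BondConfig V | ¬ (openGraph ω).Reachable x y},
          ((∫ η in (openConn x v : Set (BondConfig V)), g (openEdgeCluster η x)
              ∂(prodBernoulli fun e => if (∃ u ∈ e, (openGraph ω).Reachable y u)
                then (0 : unitInterval) else p e)) -
            (∫ η, g (openEdgeCluster η x)
              ∂(prodBernoulli fun e => if (∃ u ∈ e, (openGraph ω).Reachable y u)
                then (0 : unitInterval) else p e)) *
            (prodBernoulli fun e => if (∃ u ∈ e, (openGraph ω).Reachable y u)
                then (0 : unitInterval) else p e).real (openConn x v : Set (BondConfig V)))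
          ∂(prodBernoulli p)) ≤
      (prodBernoulli p).real ({ω : BondConfig V | ¬ (openGraph ω).Reachable v x} ∩
          {ω | ¬ (openGraph ω).Reachable v y}) *
        (∫ ω in {ω : BondConfig V | ¬ (openGraph ω).Reachable x y},
          ((prodBernoulli fun e => if (∃ u ∈ e, (openGraph ω).Reachable y u)
                then (0 : unitInterval) else p e).real
              ({η : BondConfig V | ¬ (openGraph η).Reachable v x} ∩ openConn v o) /
            (prodBernoulli fun e => if (∃ u ∈ e, (openGraph ω).Reachable y u)
                then (0 : unitInterval) else p e).real
              {η : BondConfig V | ¬ (openGraph η).Reachable v x}) *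
          ((∫ η in (openConn x v : Set (BondConfig V)), g (openEdgeCluster η x)
              ∂(prodBernoulli fun e => if (∃ u ∈ e, (openGraph ω).Reachable y u)
                then (0 : unitInterval) else p e)) -
            (∫ η, g (openEdgeCluster η x)
              ∂(prodBernoulli fun e => if (∃ u ∈ e, (openGraph ω).Reachable y u)
                then (0 : unitInterval) else p e)) *
            (prodBernoulli fun e => if (∃ u ∈ e, (openGraph ω).Reachable y u)
                then (0 : unitInterval) else p e).real (openConn x v : Set (BondConfig V)))
          ∂(prodBernoulli p)) := by
  intro p hp g hg hg0
  have h := hP1 p hp g hg hg0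
  rw [Ef_univ_singleton, Mf_univ_singleton, YfE_univ_singleton, XfE_univ_singleton] at h
  exact h

/-- **COV(τ) from the sum-form diagonal inequality** (`covTau_of_diagonal ∘ diagonal_of_sumForm`): for every weight `w`,
every monotone edge-cluster functional `f`, owner `x`, avoided `y`, observers `o`, `v ≠ x`.
[cite: VandenbergHaggstromKahn2005, Thms. 1.3–1.4 (pp. 6–7), §2.1 (pp. 9–13)] [cite: KozmaNitzan2024, Lemma 2 (p. 6)] -/
theorem covTau_of_sumForm (w : Sym2 V → unitInterval) (x y o v : V) (hvx : v ≠ x)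
    (hP1 : ∀ p : Sym2 V → unitInterval, (∀ e, 0 < p e ∧ p e < 1) →
      ∀ g : Set (Sym2 V) → ℝ, Monotone g → (∀ C, 0 ≤ g C) →
      Ef (fun e => (p e : ℝ)) Finset.univ x o v ({y} : Set V) * YfE (fun e => (p e : ℝ)) Finset.univ x v g ({y} : Set V) ≤
        Mf (fun e => (p e : ℝ)) Finset.univ x v ({y} : Set V) * XfE (fun e => (p e : ℝ)) Finset.univ x o v g ({y} : Set V))
    (f : Set (Sym2 V) → ℝ) (hf : Monotone f) :
    (prodBernoulli w).real ({ω : BondConfig V | ¬ (openGraph ω).Reachable v x} ∩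
          {ω | ¬ (openGraph ω).Reachable v y} ∩ openConn v o) *
        ((prodBernoulli w).real {ω : BondConfig V | ¬ (openGraph ω).Reachable x y} *
            (∫ ω in {ω : BondConfig V | ¬ (openGraph ω).Reachable x y} ∩ openConn x v,
              f (openEdgeCluster ω x) ∂(prodBernoulli w)) -
          (∫ ω in {ω : BondConfig V | ¬ (openGraph ω).Reachable x y},
              f (openEdgeCluster ω x) ∂(prodBernoulli w)) *
            (prodBernoulli w).real ({ω : BondConfig V | ¬ (openGraph ω).Reachable x y} ∩ openConn x v)) ≤
      (prodBernoulli w).real ({ω : BondConfig V | ¬ (openGraph ω).Reachable v x} ∩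
          {ω | ¬ (openGraph ω).Reachable v y}) *
        ((prodBernoulli w).real {ω : BondConfig V | ¬ (openGraph ω).Reachable x y} *
            (∫ ω in {ω : BondConfig V | ¬ (openGraph ω).Reachable x y} ∩ openConn x o,
              f (openEdgeCluster ω x) ∂(prodBernoulli w)) -
          (∫ ω in {ω : BondConfig V | ¬ (openGraph ω).Reachable x y},
              f (openEdgeCluster ω x) ∂(prodBernoulli w)) *
            (prodBernoulli w).real ({ω : BondConfig V | ¬ (openGraph ω).Reachable x y} ∩ openConn x o)) :=
  covTau_of_diagonal w x y o v hvx (diagonal_of_sumForm x y o v hP1) f hf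

end CovTau

end Summit.CriticalPhenomena.PercolationContinuityZ3.Theorems

end
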